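import Summits.HodgeConjecture.HodgeConjecture.Theorems.VHCAbelianSchemesRoadRegimeDefs
import Summits.HodgeConjecture.HodgeConjecture.Theorems.Ring2SemiregularRepresentativesVacuity
import HarnessLib

/-!
# Item `SemiregularSheafRepresentativesLefAt` (stmt-HodgeConjecture-19779, aside of road b02), line `birth` — stub `stub_lefschetzRegime` PROVED

research route conditional on HC_CM; not a corollary; Q11.4-sentence-2 already refuted in dim ≥ 3.

THE NULL SHEAF CLOSES REGIME 1 OF THE UNTWISTED SKELETON. In the Lefschetz regime of K-SR♭∃ for the Buchweitz–Flenner sheaf door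
(`LefAtLefschetzRegime (bfSheafClass C)`: `W` is an algebraic Lefschetz class on EVERY fibre) the conclusion holds at the anchor
fibre itself (`s₁ := s₀`) with `I := {p}`, `κ := 0`, `V := 0`, `a := 1`, `Z := −W` and the ZERO SHEAF (finite locally free of
rank `0`, `I`-semiregular since `Ext²(0,0) = 0`, `ch(0) = 0`): `admissibleRepresentativesLef_pointwise_of_lefschetz` (p408365) fed
by `hasNullDatum_bfSheafClass` (vacuity certificate, p408180). This is **`stub_lefschetzRegime`**, the REGISTERED stub 1 of the
skeleton `Cruxes/SemiregularSheafRepresentativesLefAt/Lines/birth.lean` (sha 29ec062c…, ring2 LEAD gen 145), signature verbatim over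
the importable constant `Ring2.SemiregularRepresentatives.LefAtLefschetzRegime` (byte-identical body to the skeleton's local
`…Birth.LefAtLefschetzRegime`; the lead replaces the `sorry` by `exact Theorems.SemiregularSheafRepresentativesLefAt.stub_lefschetzRegime`,
both constants unfolding to the same term). After this file the item is `closed modulo {stub_exceptionalRegime}` (the research
content; `stub_rung_sixfoldMiddle` is plan-only, not used by `_of`). Nothing else is claimed; `HC_CM` occurs nowhere.

References: [cite: vanGeemen1994HodgeAV, §2.4] [cite: Bloch1972Semiregularity, Remark (7.5)] [cite: BuchweitzFlenner2003, §5 Def. 4.10 and Thm. 5.1]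
[cite: Fulton1998, Example 3.2.3].
-/

noncomputable section

open CategoryTheory CategoryTheory.Limits AlgebraicGeometry Topology

-- the cell's namespace repeats the summit name (`Summit.HodgeConjecture.HodgeConjecture…`), as in every `Ring2*` file
set_option linter.dupNamespace false

namespace Summit.HodgeConjecture.HodgeConjecture.Theorems.SemiregularSheafRepresentativesLefAt

open Literature.AlgebraicGeometry.HodgeTheory
open Summit.Ventures.HSemireg (bfSheafClass)
open Summit.HodgeConjecture.HodgeConjecture.Ring2.SemiregularRepresentatives

/-- **Stub `stub_lefschetzRegime` of item `SemiregularSheafRepresentativesLefAt` (stmt-HodgeConjecture-19779), line `birth`,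
REGISTERED SIGNATURE VERBATIM** — the Lefschetz regime of K-SR♭∃ for the sheaf door `bfSheafClass C`, every Chern character
theory `C`: the zero sheaf at the anchor fibre (`s₁ := s₀`, `I = {p}`, `κ = 0`, `V = 0`, `a = 1`, `Z = −W`).
[cite: vanGeemen1994HodgeAV, §2.4] [cite: Bloch1972Semiregularity, Remark (7.5)] [cite: BuchweitzFlenner2003, §5 Def. 4.10]
[cite: Fulton1998, Example 3.2.3] -/
theorem stub_lefschetzRegime : ∀ C : ChernCharacterBetti, LefAtLefschetzRegime (bfSheafClass C) := by
  intro C n 𝒳 S f hf h𝒳 hirr haff hsm hdim habel he p W hW s₀ hs₀ hL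
  obtain ⟨I, κ, V, a, Z, h⟩ :=
    admissibleRepresentativesLef_pointwise_of_lefschetz (hasNullDatum_bfSheafClass C) f W hW hL s₀
  exact ⟨s₀, I, κ, V, a, Z, h⟩

end Summit.HodgeConjecture.HodgeConjecture.Theorems.SemiregularSheafRepresentativesLefAt

end
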